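import Mathlib
import HarnessLib
import Literature.Analysis.FluidPDE.SelfSimilar
import Literature.Analysis.FluidPDE.VectorCalculus
import Literature.Analysis.FluidPDE.AxisymHouLiVariables
import Literature.Analysis.FluidPDE.NSBoundedMildOseen
import Literature.Analysis.UnboundedOperators.HeatKernel
import Summits.NavierStokesRegularity.NavierStokesRegularity.Theorems.PoloidalWindowDoorPoloidalWindowRigidityTypeIAnalytic

/-!
# Route `PoloidalWindowDoor`, crux `PoloidalWindowRigidity` (stmt-NavierStokesRegularity-19708) — LINE 16 «zero_mode» (ns-idea-8 g8, v1.1), stub F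
# `stub_fluxTransport`: INCOMPRESSIBILITY TRANSPORTS THE HOT-PLANE VALUE TO THE FLAT BOXES UP TO THE LATERAL FLUX

Cell ns-regularity-ideate, seat ns-poloidal-K2-p2 g12 (K2 hand).  Statement = the body of `FluxTransport` (`Cruxes/PoloidalWindowRigidity/Lines/zero_mode.lean`)
VERBATIM, with the Cruxes-local `flatBox R H` unfolded to its set-builder `{x | |x 0| ≤ R ∧ |x 1| ≤ R ∧ 0 ≤ x 2 ∧ x 2 ≤ H}` (same convention as A1
`stub_hotPlaneConst` / `Pinned`): if `v₂(t,·) ≡ N := v₂(t,0)` on the plane `P₀ = {y 2 = 0}` then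
`|∫_{Q_{R,H}} v₂(t) − N·4R²H| ≤ M·R·H²` for all `R, H > 0` (here `M = 8‖v(t)‖_∞ ≤ 8C/√(−t)`).

PROOF.  ONE application of Mathlib's box divergence theorem `MeasureTheory.integral_divergence_of_hasFDerivAt_off_countable` on
`[−R,R]²×[0,H] ⊂ Fin 3 → ℝ` to the field `W(p) = (H − p₂)·v(t,p)`: `div W = (H − p₂)·div v − v₂ = −v₂` (`divergence_eq_sum_three`, `IsDivFree`); the top
face carries `W = 0`, the bottom face carries `H·N` (hot-plane hypothesis) over the square of area `4R²`, and each of the four lateral face integrals is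
`≤ H‖v(t)‖_∞ · 2RH`.  The `E3` set integral is transported to `Fin 3 → ℝ` by `PiLp.volume_preserving_ofLp` (`setIntegral_flatBox`); slices are `C¹` by the
tree's `…TypeIAnalytic.typeI_mild_slice_analytic` (real-analytic), bounded by `HasTypeITimeDecay`.

WHAT THIS IS NOT: a calculus identity for ONE stub of an un-led line; Z-heat / Z-oseen / C2a / C2b / S0 / the wall ⟨27893⟩ are untouched; 19708 / 20428 OPEN;
no claim about Navier–Stokes regularity.
-/

noncomputable section

-- the summit and its single sub-problem share the name (CONVENTIONS §1), as in every Theorems file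
set_option linter.dupNamespace false

namespace Summit.NavierStokesRegularity.NavierStokesRegularity.Theorems.PoloidalWindowDoorPoloidalWindowRigidityFluxTransport

open MeasureTheory Set Function Filter Topology
open scoped RealInnerProductSpace ENNReal
open Literature.Analysis Literature.Analysis.FluidPDE Literature.Analysis.UnboundedOperators
open Summit.NavierStokesRegularity.NavierStokesRegularity.Theorems.PoloidalWindowDoorPoloidalWindowRigidityTypeIAnalytic

/-! ## The flat box as a coordinate box -/

/-- The corners `(−R,−R,0) ≤ (R,R,H)` of the coordinate box, for `R, H ≥ 0`. [folklore] -/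
theorem boxLo_le_boxHi {R H : ℝ} (hR : 0 ≤ R) (hH : 0 ≤ H) : (![-R, -R, 0] : Fin 3 → ℝ) ≤ ![R, R, H] := by
  intro i
  fin_cases i <;> simp <;> linarith

/-- The flat box `{|x 0| ≤ R ∧ |x 1| ≤ R ∧ 0 ≤ x 2 ∧ x 2 ≤ H}` is the preimage under the coordinate map `ofLp` of the box
`[(−R,−R,0), (R,R,H)] ⊂ Fin 3 → ℝ`. [folklore] -/
theorem flatBox_eq_preimage (R H : ℝ) :
    {x : EuclideanSpace ℝ (Fin 3) | |x 0| ≤ R ∧ |x 1| ≤ R ∧ 0 ≤ x 2 ∧ x 2 ≤ H} =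
      (WithLp.ofLp : EuclideanSpace ℝ (Fin 3) → (Fin 3 → ℝ)) ⁻¹' Icc (![-R, -R, 0] : Fin 3 → ℝ) ![R, R, H] := by
  ext x
  simp only [mem_setOf_eq, mem_preimage, mem_Icc, Pi.le_def]
  constructor
  · rintro ⟨h0, h1, h2, h3⟩
    obtain ⟨h0a, h0b⟩ := abs_le.1 h0
    obtain ⟨h1a, h1b⟩ := abs_le.1 h1
    refine ⟨fun i => ?_, fun i => ?_⟩ <;> fin_cases i <;> simp <;> assumption
  · rintro ⟨hlo, hhi⟩
    have h0a := hlo 0; have h0b := hhi 0; have h1a := hlo 1; have h1b := hhi 1; have h2a := hlo 2; have h2b := hhi 2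
    simp at h0a h0b h1a h1b h2a h2b
    exact ⟨abs_le.2 ⟨h0a, h0b⟩, abs_le.2 ⟨h1a, h1b⟩, h2a, h2b⟩

/-- The coordinate map `ofLp : E3 → (Fin 3 → ℝ)` is a measurable embedding. [folklore] -/
theorem measurableEmbedding_ofLp :
    MeasurableEmbedding (WithLp.ofLp : EuclideanSpace ℝ (Fin 3) → (Fin 3 → ℝ)) :=
  (MeasurableEquiv.toLp 2 (Fin 3 → ℝ)).symm.measurableEmbedding

/-- **Transport of flat-box integrals to coordinates**: `∫_{Q_{R,H}} f = ∫_{[(−R,−R,0),(R,R,H)]} f ∘ toLp` (volume preservation of `ofLp`). [folklore] -/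
theorem setIntegral_flatBox {G : Type*} [NormedAddCommGroup G] [NormedSpace ℝ G]
    (f : EuclideanSpace ℝ (Fin 3) → G) (R H : ℝ) :
    ∫ x in {x : EuclideanSpace ℝ (Fin 3) | |x 0| ≤ R ∧ |x 1| ≤ R ∧ 0 ≤ x 2 ∧ x 2 ≤ H}, f x =
      ∫ p in Icc (![-R, -R, 0] : Fin 3 → ℝ) ![R, R, H], f (WithLp.toLp 2 p) := by
  rw [flatBox_eq_preimage]
  have h := (PiLp.volume_preserving_ofLp (Fin 3)).setIntegral_preimage_emb measurableEmbedding_ofLp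
    (fun p => f (WithLp.toLp 2 p)) (Icc (![-R, -R, 0] : Fin 3 → ℝ) ![R, R, H])
  simpa using h

/-- **Volume of the flat box**: `|Q_{R,H}| = 4R²H`. [folklore] -/
theorem volume_flatBox {R : ℝ} (H : ℝ) (hR : 0 ≤ R) :
    volume {x : EuclideanSpace ℝ (Fin 3) | |x 0| ≤ R ∧ |x 1| ≤ R ∧ 0 ≤ x 2 ∧ x 2 ≤ H} = ENNReal.ofReal (4 * R ^ 2 * H) := by
  rw [flatBox_eq_preimage, (PiLp.volume_preserving_ofLp (Fin 3)).measure_preimage_emb measurableEmbedding_ofLp,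
    Real.volume_Icc_pi, Fin.prod_univ_three]
  simp only [Matrix.cons_val_zero, Matrix.cons_val_one, Matrix.cons_val_two, Matrix.head_cons, Matrix.tail_cons, sub_neg_eq_add, sub_zero]
  rw [← ENNReal.ofReal_mul (by linarith), ← ENNReal.ofReal_mul (by positivity)]
  congr 1
  ring

/-! ## Face bookkeeping on `Fin 3` -/

/-- Face bookkeeping: `(2 : Fin 3).succAbove 0 = 0`. [folklore] -/
theorem succAbove_two_zero : (2 : Fin 3).succAbove 0 = 0 := by decide
/-- Face bookkeeping: `(2 : Fin 3).succAbove 1 = 1`. [folklore] -/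
theorem succAbove_two_one : (2 : Fin 3).succAbove 1 = 1 := by decide
/-- Face bookkeeping: `(0 : Fin 3).succAbove 0 = 1`. [folklore] -/
theorem succAbove_zero_zero : (0 : Fin 3).succAbove 0 = 1 := by decide
/-- Face bookkeeping: `(0 : Fin 3).succAbove 1 = 2`. [folklore] -/
theorem succAbove_zero_one : (0 : Fin 3).succAbove 1 = 2 := by decide
/-- Face bookkeeping: `(1 : Fin 3).succAbove 0 = 0`. [folklore] -/
theorem succAbove_one_zero : (1 : Fin 3).succAbove 0 = 0 := by decide
/-- Face bookkeeping: `(1 : Fin 3).succAbove 1 = 2`. [folklore] -/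
theorem succAbove_one_one : (1 : Fin 3).succAbove 1 = 2 := by decide

/-- The measure of a face box `[a ∘ i.succAbove, b ∘ i.succAbove] ⊂ Fin 2 → ℝ` is finite. [folklore] -/
theorem volume_face_lt_top (a b : Fin 2 → ℝ) : volume (Icc a b) < ∞ :=
  isCompact_Icc.measure_lt_top

/-- Bookkeeping: from the divergence identity `−I = (T₀⁺ − T₀⁻) + (T₁⁺ − T₁⁻) + (0 − N′)` and `|T| ≤ K` for the four lateral
face integrals, `|I − N′| ≤ 4K`. [folklore] -/
theorem abs_sub_le_of_faces {I N' T0f T0b T1f T1b K : ℝ}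
    (h : -I = (T0f - T0b) + (T1f - T1b) + (0 - N')) (h0f : |T0f| ≤ K) (h0b : |T0b| ≤ K)
    (h1f : |T1f| ≤ K) (h1b : |T1b| ≤ K) : |I - N'| ≤ 4 * K := by
  obtain ⟨a1, a2⟩ := abs_le.1 h0f
  obtain ⟨b1, b2⟩ := abs_le.1 h0b
  obtain ⟨c1, c2⟩ := abs_le.1 h1f
  obtain ⟨d1, d2⟩ := abs_le.1 h1b
  rw [abs_le]
  constructor <;> linarith

/-! ## Stub F -/

/-- **Stub F `stub_fluxTransport` of LINE 16 «zero_mode» (VERBATIM body of `FluxTransport`, `flatBox` unfolded).**  See the module docstring. -/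
theorem stub_fluxTransport :
    ∀ (C : ℝ) (v : ℝ → EuclideanSpace ℝ (Fin 3) → EuclideanSpace ℝ (Fin 3)),
    Literature.Analysis.FluidPDE.HasTypeITimeDecay C v →
    ContinuousOn (Function.uncurry v) (Set.Iio (0 : ℝ) ×ˢ Set.univ) →
    (∀ s t : ℝ, s < t → t < 0 → ∀ x, v t x =
      Literature.Analysis.UnboundedOperators.heatExtension (v s) (t - s) x -
        Literature.Analysis.FluidPDE.oseenDuhamel 1 s v v t x) →
    (∀ t < 0, Literature.Analysis.FluidPDE.VectorCalculus.IsDivFree (v t)) →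
    ∀ t : ℝ, t < 0 → (∀ y : EuclideanSpace ℝ (Fin 3), y 2 = 0 → v t y 2 = v t 0 2) →
      ∃ M : ℝ, ∀ R H : ℝ, 0 < R → 0 < H →
        |(∫ x in {x : EuclideanSpace ℝ (Fin 3) | |x 0| ≤ R ∧ |x 1| ≤ R ∧ 0 ≤ x 2 ∧ x 2 ≤ H}, v t x 2) -
          v t 0 2 * (4 * R ^ 2 * H)| ≤ M * R * H ^ 2 := by
  intro C v hT hcont hmild hdiv t ht hplane
  -- the slice `u = v(t)`: bounded, real-analytic (hence `C¹`), divergence free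
  set u : EuclideanSpace ℝ (Fin 3) → EuclideanSpace ℝ (Fin 3) := v t with hu
  set N : ℝ := v t 0 2 with hN
  set B : ℝ := C / Real.sqrt (-t) with hB
  have hBd : ∀ x, ‖u x‖ ≤ B := fun x => hT t ht x
  have hB0 : 0 ≤ B := (norm_nonneg _).trans (hBd 0)
  have hA : AnalyticOnNhd ℝ u univ := typeI_mild_slice_analytic C v hT hcont hmild t ht
  have hud : Differentiable ℝ u := fun x => (hA x (mem_univ x)).differentiableAt
  have huc : Continuous u := hud.continuous
  have hdiv0 : ∀ x, fderiv ℝ u x (EuclideanSpace.single 0 1) 0 + fderiv ℝ u x (EuclideanSpace.single 1 1) 1 +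
      fderiv ℝ u x (EuclideanSpace.single 2 1) 2 = 0 := fun x => by
    rw [← divergence_eq_sum_three]; exact hdiv t ht x
  refine ⟨8 * B, fun R H hR hH => ?_⟩
  -- ## the field `W(p) = (H − p 2) • u(p)` on `Fin 3 → ℝ`
  set eL : EuclideanSpace ℝ (Fin 3) ≃L[ℝ] (Fin 3 → ℝ) := EuclideanSpace.equiv (Fin 3) ℝ with heL
  have heL_apply : ∀ x : EuclideanSpace ℝ (Fin 3), eL x = WithLp.ofLp x := fun x => rfl
  have heL_symm : ∀ p : Fin 3 → ℝ, eL.symm p = WithLp.toLp 2 p := fun p => rfl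
  set g : (Fin 3 → ℝ) → (Fin 3 → ℝ) := fun p => eL (u (eL.symm p)) with hg
  set Dg : (Fin 3 → ℝ) → (Fin 3 → ℝ) →L[ℝ] (Fin 3 → ℝ) := fun p =>
    (eL : EuclideanSpace ℝ (Fin 3) →L[ℝ] (Fin 3 → ℝ)).comp
      ((fderiv ℝ u (eL.symm p)).comp (eL.symm : (Fin 3 → ℝ) →L[ℝ] EuclideanSpace ℝ (Fin 3))) with hDg
  have hgd : ∀ p, HasFDerivAt g (Dg p) p := by
    intro p
    have h1 : HasFDerivAt (fun q => u (eL.symm q))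
        ((fderiv ℝ u (eL.symm p)).comp (eL.symm : (Fin 3 → ℝ) →L[ℝ] EuclideanSpace ℝ (Fin 3))) p :=
      (hud _).hasFDerivAt.comp p eL.symm.hasFDerivAt
    exact eL.hasFDerivAt.comp p h1
  set φ : (Fin 3 → ℝ) → ℝ := fun p => H - p 2 with hφ
  set π₂ : (Fin 3 → ℝ) →L[ℝ] ℝ := ContinuousLinearMap.proj 2 with hπ₂
  have hφd : ∀ p, HasFDerivAt φ (-π₂) p := by
    intro p
    have h2 : HasFDerivAt (fun q : Fin 3 → ℝ => q 2) π₂ p := π₂.hasFDerivAt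
    have h3 : HasFDerivAt (fun q : Fin 3 → ℝ => H - q 2) ((0 : (Fin 3 → ℝ) →L[ℝ] ℝ) - π₂) p :=
      (hasFDerivAt_const H p).sub h2
    rw [zero_sub] at h3
    exact h3
  set f : (Fin 3 → ℝ) → (Fin 3 → ℝ) := fun p => φ p • g p with hf
  set f' : (Fin 3 → ℝ) → (Fin 3 → ℝ) →L[ℝ] (Fin 3 → ℝ) := fun p => φ p • Dg p + (-π₂).smulRight (g p) with hf'
  have hfd : ∀ p, HasFDerivAt f (f' p) p := fun p => (hφd p).smul (hgd p)
  have hfc : Continuous f := by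
    have h1 : Continuous g := eL.continuous.comp (huc.comp eL.symm.continuous)
    have h2 : Continuous φ := continuous_const.sub (continuous_apply 2)
    exact h2.smul h1
  -- ## its divergence is `−u₂`
  have hdivf : ∀ p, ∑ i, f' p (Pi.single i 1) i = -(u (WithLp.toLp 2 p) 2) := by
    intro p
    have hDg_apply : ∀ i j, Dg p (Pi.single i 1) j = fderiv ℝ u (WithLp.toLp 2 p) (EuclideanSpace.single i 1) j := by
      intro i j; rfl
    have hg_apply : ∀ j, g p j = u (WithLp.toLp 2 p) j := fun j => rfl
    have hf'_apply : ∀ i j, f' p (Pi.single i 1) j =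
        (H - p 2) * Dg p (Pi.single i 1) j + -((Pi.single i (1 : ℝ) : Fin 3 → ℝ) 2) * g p j := by
      intro i j
      simp only [hf', hφ, hπ₂]
      rfl
    simp only [Fin.sum_univ_three, hf'_apply, hDg_apply, hg_apply, Pi.single_apply]
    have := hdiv0 (WithLp.toLp 2 p)
    simp only [Fin.isValue, Fin.reduceEq, if_false, if_true]
    linear_combination (H - p 2) * this
  -- ## the divergence theorem on `[(−R,−R,0), (R,R,H)]`
  have hle := boxLo_le_boxHi hR.le hH.le
  have hHi : IntegrableOn (fun p => ∑ i, f' p (Pi.single i 1) i) (Icc (![-R, -R, 0] : Fin 3 → ℝ) ![R, R, H]) := by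
    rw [show (fun p => ∑ i, f' p (Pi.single i 1) i) = fun p => -(u (WithLp.toLp 2 p) 2) from funext hdivf]
    have : Continuous fun p : Fin 3 → ℝ => -(u (WithLp.toLp 2 p) 2) := by
      have h1 : Continuous fun p : Fin 3 → ℝ => u (WithLp.toLp 2 p) := huc.comp (PiLp.continuous_toLp 2 _)
      exact ((continuous_apply 2).comp ((PiLp.continuous_ofLp 2 _).comp h1)).neg
    exact this.integrableOn_Icc
  have hDT := integral_divergence_of_hasFDerivAt_off_countable (![-R, -R, 0] : Fin 3 → ℝ) ![R, R, H] hle f f' ∅ countable_empty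
    hfc.continuousOn (fun p _ => hfd p) hHi
  -- LHS = −∫_Q u₂
  have hLHS : ∫ p in Icc (![-R, -R, 0] : Fin 3 → ℝ) ![R, R, H], ∑ i, f' p (Pi.single i 1) i =
      -∫ x in {x : EuclideanSpace ℝ (Fin 3) | |x 0| ≤ R ∧ |x 1| ≤ R ∧ 0 ≤ x 2 ∧ x 2 ≤ H}, u x 2 := by
    rw [setIntegral_congr_fun measurableSet_Icc (fun p _ => hdivf p), integral_neg, setIntegral_flatBox]
  -- values of `f` on the faces
  have hf_apply : ∀ p i, f p i = (H - p 2) * u (WithLp.toLp 2 p) i := fun p i => rfl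
  -- top face: `f = 0`
  have htop : ∀ y : Fin 2 → ℝ, f (Fin.insertNth 2 (![R, R, H] 2 : ℝ) y) 2 = 0 := by
    intro y; rw [hf_apply, Fin.insertNth_apply_same]
    simp
  -- bottom face: `f₂ = H·N`
  have hbot : ∀ y : Fin 2 → ℝ, f (Fin.insertNth 2 (![-R, -R, 0] 2 : ℝ) y) 2 = H * N := by
    intro y
    rw [hf_apply, Fin.insertNth_apply_same]
    simp only [Matrix.cons_val_two, Matrix.tail_cons, Matrix.head_cons, sub_zero]
    congr 1
    apply hplane
    show (Fin.insertNth 2 (0 : ℝ) y : Fin 3 → ℝ) 2 = 0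
    exact Fin.insertNth_apply_same _ _ _
  -- lateral faces: `|f i| ≤ H·B`
  have hlat : ∀ (i : Fin 3) (c : ℝ) (y : Fin 2 → ℝ) (j : Fin 2), i.succAbove j = 2 →
      y ∈ Icc ((![-R, -R, 0] : Fin 3 → ℝ) ∘ i.succAbove) ((![R, R, H] : Fin 3 → ℝ) ∘ i.succAbove) → ‖f (Fin.insertNth i c y) i‖ ≤ H * B := by
    intro i c y j hj hy
    have hy2 : 0 ≤ y j ∧ y j ≤ H := by
      have h1 := hy.1 j; have h2 := hy.2 j
      simp only [comp_apply, hj, Matrix.cons_val_two, Matrix.tail_cons, Matrix.head_cons] at h1 h2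
      exact ⟨h1, h2⟩
    have hp2 : (Fin.insertNth i c y : Fin 3 → ℝ) 2 = y j := by
      rw [← hj, Fin.insertNth_apply_succAbove]
    rw [hf_apply, norm_mul, Real.norm_eq_abs, hp2, abs_of_nonneg (by linarith)]
    have hcomp : ‖u (WithLp.toLp 2 (Fin.insertNth i c y)) i‖ ≤ B :=
      (PiLp.norm_apply_le _ i).trans (hBd _)
    exact mul_le_mul (by linarith) hcomp (norm_nonneg _) hH.le
  -- face volumes
  have hvol0 : volume.real (Icc ((![-R, -R, 0] : Fin 3 → ℝ) ∘ (0 : Fin 3).succAbove) ((![R, R, H] : Fin 3 → ℝ) ∘ (0 : Fin 3).succAbove)) = 2 * R * H := by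
    rw [measureReal_def, Real.volume_Icc_pi_toReal (a := (![-R, -R, 0] : Fin 3 → ℝ) ∘ (0 : Fin 3).succAbove) (b := (![R, R, H] : Fin 3 → ℝ) ∘ (0 : Fin 3).succAbove)
      (fun j => hle _), Fin.prod_univ_two]
    simp only [comp_apply, succAbove_zero_zero, succAbove_zero_one, Matrix.cons_val_zero, Matrix.cons_val_one, Matrix.cons_val_two,
      Matrix.head_cons, Matrix.tail_cons]
    ring
  have hvol1 : volume.real (Icc ((![-R, -R, 0] : Fin 3 → ℝ) ∘ (1 : Fin 3).succAbove) ((![R, R, H] : Fin 3 → ℝ) ∘ (1 : Fin 3).succAbove)) = 2 * R * H := by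
    rw [measureReal_def, Real.volume_Icc_pi_toReal (a := (![-R, -R, 0] : Fin 3 → ℝ) ∘ (1 : Fin 3).succAbove) (b := (![R, R, H] : Fin 3 → ℝ) ∘ (1 : Fin 3).succAbove)
      (fun j => hle _), Fin.prod_univ_two]
    simp only [comp_apply, succAbove_one_zero, succAbove_one_one, Matrix.cons_val_zero, Matrix.cons_val_two, Matrix.head_cons, Matrix.tail_cons]
    ring
  have hvol2 : volume.real (Icc ((![-R, -R, 0] : Fin 3 → ℝ) ∘ (2 : Fin 3).succAbove) ((![R, R, H] : Fin 3 → ℝ) ∘ (2 : Fin 3).succAbove)) = 4 * R ^ 2 := by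
    rw [measureReal_def, Real.volume_Icc_pi_toReal (a := (![-R, -R, 0] : Fin 3 → ℝ) ∘ (2 : Fin 3).succAbove) (b := (![R, R, H] : Fin 3 → ℝ) ∘ (2 : Fin 3).succAbove)
      (fun j => hle _), Fin.prod_univ_two]
    simp only [comp_apply, succAbove_two_zero, succAbove_two_one, Matrix.cons_val_zero, Matrix.cons_val_one]
    ring
  -- lateral face integrals are `≤ H·B·2RH`
  have hface : ∀ (i : Fin 3) (c : ℝ) (j : Fin 2), i.succAbove j = 2 →
      volume.real (Icc ((![-R, -R, 0] : Fin 3 → ℝ) ∘ i.succAbove) ((![R, R, H] : Fin 3 → ℝ) ∘ i.succAbove)) = 2 * R * H →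
      |∫ y in Icc ((![-R, -R, 0] : Fin 3 → ℝ) ∘ i.succAbove) ((![R, R, H] : Fin 3 → ℝ) ∘ i.succAbove), f (Fin.insertNth i c y) i| ≤ H * B * (2 * R * H) := by
    intro i c j hj hv
    rw [← Real.norm_eq_abs, ← hv]
    exact norm_setIntegral_le_of_norm_le_const (volume_face_lt_top _ _) fun y hy => hlat i c y j hj hy
  have h0f := hface 0 (![R, R, H] 0 : ℝ) 1 succAbove_zero_one hvol0
  have h0b := hface 0 (![-R, -R, 0] 0 : ℝ) 1 succAbove_zero_one hvol0
  have h1f := hface 1 (![R, R, H] 1 : ℝ) 1 succAbove_one_one hvol1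
  have h1b := hface 1 (![-R, -R, 0] 1 : ℝ) 1 succAbove_one_one hvol1
  -- top and bottom integrals
  have h2f : ∫ y in Icc ((![-R, -R, 0] : Fin 3 → ℝ) ∘ (2 : Fin 3).succAbove) ((![R, R, H] : Fin 3 → ℝ) ∘ (2 : Fin 3).succAbove),
      f (Fin.insertNth 2 (![R, R, H] 2 : ℝ) y) 2 = 0 := by
    rw [setIntegral_congr_fun measurableSet_Icc (fun y _ => htop y), integral_zero]
  have h2b : ∫ y in Icc ((![-R, -R, 0] : Fin 3 → ℝ) ∘ (2 : Fin 3).succAbove) ((![R, R, H] : Fin 3 → ℝ) ∘ (2 : Fin 3).succAbove),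
      f (Fin.insertNth 2 (![-R, -R, 0] 2 : ℝ) y) 2 = H * N * (4 * R ^ 2) := by
    rw [setIntegral_congr_fun measurableSet_Icc (fun y _ => hbot y), setIntegral_const, hvol2, smul_eq_mul]
    ring
  -- ## assemble
  rw [hLHS, Fin.sum_univ_three, h2f, h2b] at hDT
  have hfin := abs_sub_le_of_faces hDT h0f h0b h1f h1b
  have e1 : H * N * (4 * R ^ 2) = N * (4 * R ^ 2 * H) := by ring
  have e2 : 4 * (H * B * (2 * R * H)) = 8 * B * R * H ^ 2 := by ring
  rw [e1, e2] at hfin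
  exact hfin

end Summit.NavierStokesRegularity.NavierStokesRegularity.Theorems.PoloidalWindowDoorPoloidalWindowRigidityFluxTransport

end
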